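/-
Copyright (c) 2026 the pub-hodgecm-mathlib formalisation cell (harness21).  Prover seat hodgecm-mathlib-F0P2-p06 (g12), 2026-09-01.  Road «S3-ram» seeding wave (LEAD F0P3a-plan (g12)
T11-41; owner F0P3a-p06 (g15)); «O8c-ram» FILE 4: STUB B′ of A-p16 (g31)'s P-1-ram skeleton v3 8028ac4cce50972f (`stub_typeOne_HSideBasis_ram`, the PINNED family `ψ^ram = ![χ⁰, χ♯]`).
-/
import Literature.NumberTheory.Rogawski1990.DepthZeroTransferHValuesTypeOneRamified             -- ★ p846978 (this seat): STUB B of the v0 skeleton — the two profiles of `χ⁰`, `χ♯`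
import HarnessLib

/-!
# STUB B′ of the v3 P-1-ram skeleton: the PINNED H-side family `ψ^ram = ![χ⁰, χ♯]` at a tame-ramified place is smooth and its profiles depend on the depth only

Topic `NumberTheory/Rogawski1990`; namespace `Literature.NumberTheory.Rogawski1990`.  THEOREMS ONLY (no definition, no instance, no notation, no named fact, no `sorry`); kernel lane
`--supports stmt-HodgeConjecture-24833`.  Cell `pub/hodgecm-mathlib`, crux H413; road «S3-ram» seeding wave; organ **«O8c-ram» FILE 4** = the text of `stub_typeOne_HSideBasis_ram` of
A-p16 (g31)'s skeleton **v3** (`F0/P3a/A-p16/g31/DepthZeroKappaTransferTypeOneRamified.skeleton.v3.A-p16g31.lean`, 8028ac4cce50972f, :132) VERBATIM: for the pinned family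
`ψ^ram = ![χ⁰, χ♯]` (`χ⁰ = 1_{K_H}·[(h̄_W − 1)² = 0 ∧ rank(h̄_W − 1) = 0]` END's text, `χ♯` = the set `{h | ∀ a b, |ϖ^b ϖ^{−a} (h_{2,w})_{ab}|_w ≤ 1}` = `K♯ × U₁`), (i) both members are
in `C_c^∞(H_v)` (★ p846285 `isLocSmooth_indicator_ite_redMat` for `χ⁰`; for `χ♯` the set is the compact open subgroup `K♯ × U₁` of ★ `exists_vertexCover_of_ramified`, by ★
`coe_mem_map_conj_glDiagonal_iff_forall_v_le_one`), and (ii) their stable orbital integrals on the deep `G`-regular elliptic type-(1) population are `ν_H(K_H)·Y s N` — ★ p846978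
`stableOrbitalIntegralRel_typeOne_HSideProfiles_ramified` read through `![·,·] s` (`s = 0, 1`).  HONEST LABEL: HC_CM is proved only modulo the cell's 2 remaining named inputs
(hLiu418 24832, h413 24833) until rung 0 closes; «S3-ram» is Literature seeding with no books consequence; this file is bookkeeping over ★ material.

* `isLocSmooth_indicator_setOf_conj_glDiagonal_ramified` (`χ♯ ∈ C_c^∞`), **`stableOrbitalIntegralRel_typeOne_HSidePinnedBasis_ramified`** (= v3's `stub_typeOne_HSideBasis_ram` VERBATIM).

## References
* [Rogawski1990] J. D. Rogawski, *Automorphic Representations of Unitary Groups in Three Variables*, Ann. of Math. Stud. 123 (1990): §4.9 Lemma 4.9.3 p. 56, Prop. 4.9.1 (b) p. 55;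
  §8.1 Prop. 8.1.1 p. 112.
* [LabesseLanglands1979] J.-P. Labesse, R. P. Langlands, *L-indistinguishability for SL(2)*, Canad. J. Math. 31 (1979): §2 Lemma 2.1 pp. 8–9, §5.
* [Serre1980Trees] J.-P. Serre, *Trees* (1980): Ch. II §1.1.
-/

set_option autoImplicit false

noncomputable section

open Set Filter Topology MeasureTheory Measure NumberField IsDedekindDomain Finset Matrix Polynomial ValuativeRel Function MulAction
open scoped Matrix MatrixGroups ValuativeRel WithZero

namespace Literature.NumberTheory.Rogawski1990

open Literature.NumberTheory.Automorphic Literature.NumberTheory.Automorphic.UnitaryGroup Literature.NumberTheory.Automorphic.IntegralReduction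
open Literature.NumberTheory.GaloisRepresentations

-- `L_w`-sized statement: elaboration budget only (no search)
set_option maxHeartbeats 1600000 in
/-- **`χ♯ ∈ C_c^∞(H_v)`**: the indicator of the skeleton's set `{h | ∀ a b, |ϖ^b ϖ^{−a} (h_{2,w})_{ab}|_w ≤ 1}` is locally constant with compact support — the set is the
compact open subgroup `K♯ × U(Φ₁)_v`, `K♯ = U(Φ₂) ∩ D_ϖ GL₂(𝒪_w) D_ϖ⁻¹` (★ `exists_vertexCover_of_ramified`, ★ `coe_mem_map_conj_glDiagonal_iff_forall_v_le_one`).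
[cite: Rogawski1990, §4.9 Prop. 4.9.1 (b) p. 55] [cite: Serre1980Trees, Ch. II §1.1] -/
theorem isLocSmooth_indicator_setOf_conj_glDiagonal_ramified
    (L : Type) [Field L] [NumberField L] [IsCMField L]
    {v : HeightOneSpectrum (𝓞 ↥(maximalRealSubfield L))} (w : PlacesOver L v)
    (hw : IsCMField.complexConj L • w.1 = w.1) (he : v.asIdeal.ramificationIdx' w.1.asIdeal ≠ 1)
    (h2 : IsUnit (2 : 𝒪[(w.1.adicCompletion L)]))
    (ϖ : (w.1.adicCompletion L)) (hϖ : Valued.v ϖ = WithZero.exp (-1 : ℤ)) (hσϖ : galAdicCompletionMap (L := L) (IsCMField.complexConj L) hw ϖ = -ϖ) :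
    IsLocSmooth (Set.indicator {h : ((cmDatum L 2 (Matrix.of fun i j : Fin 2 => if i.val + j.val + 1 = 2 then (1 : L) else 0)).Local v × (cmDatum L 1 (Matrix.of fun i j : Fin 1 => if i.val + j.val + 1 = 1 then (1 : L) else 0)).Local v) | ∀ a b : Fin 2, Valued.v (ϖ ^ (b : ℕ) * (ϖ ^ (a : ℕ))⁻¹ * (((localNonsplitEquiv (IsCMField.complexConj L) (Matrix.of fun i j : Fin 2 => if i.val + j.val + 1 = 2 then (1 : L) else 0) (IsCMField.complexConj_ne_one L) w hw h.1 : ↥(unitaryGroupOfForm (galAdicCompletionMap (L := L) (IsCMField.complexConj L) hw) (placeForm (Matrix.of fun i j : Fin 2 => if i.val + j.val + 1 = 2 then (1 : L) else 0) w.1))) : GL (Fin 2) (w.1.adicCompletion L)) : Matrix (Fin 2) (Fin 2) (w.1.adicCompletion L)) a b) ≤ 1} (fun _ => (1 : ℂ))) := by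
  classical
  have h2v : Valued.v (2 : w.1.adicCompletion L) = 1 := (isUnit_two_integer_iff_valued_eq_one L w.1).1 h2
  have hϖ0 : ϖ ≠ 0 := by
    intro h0
    have h : Valued.v ϖ = 0 := by rw [h0, map_zero]
    rw [hϖ] at h
    exact WithZero.coe_ne_zero h
  obtain ⟨ϖu, hϖu⟩ : ∃ ϖu : (w.1.adicCompletion L)ˣ, (ϖu : w.1.adicCompletion L) = ϖ := ⟨Units.mk0 ϖ hϖ0, rfl⟩
  have hϖ' : Valued.v (ϖu : w.1.adicCompletion L) = WithZero.exp (-1 : ℤ) := by rw [hϖu]; exact hϖ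
  have hσϖ' : (galAdicCompletionMap (L := L) (IsCMField.complexConj L) hw) (ϖu : w.1.adicCompletion L) = -(ϖu : w.1.adicCompletion L) := by
    rw [hϖu]; exact hσϖ
  obtain ⟨K₂, -, -, hd1', hK₂o, hK₂c, -⟩ := exists_vertexCover_of_ramified L v w hw he h2v ϖu hϖ' hσϖ'
  have hK1 : cmLocalIntegralLevel L 1 (Matrix.of fun i j : Fin 1 => if i.val + j.val + 1 = 1 then (1 : L) else 0) v = ⊤ :=
    cmLocalIntegralLevel_one_eq_top_of_smul_eq L _ w hw (isUnit_placeForm_antidiagOne (E := L) 1 w.1)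
  have hopen : IsOpen (((K₂ 1).prod (⊤ : Subgroup ((cmDatum L 1 (Matrix.of fun i j : Fin 1 => if i.val + j.val + 1 = 1 then (1 : L) else 0)).Local v)) : Subgroup _) : Set ((cmDatum L 2 (Matrix.of fun i j : Fin 2 => if i.val + j.val + 1 = 2 then (1 : L) else 0)).Local v × (cmDatum L 1 (Matrix.of fun i j : Fin 1 => if i.val + j.val + 1 = 1 then (1 : L) else 0)).Local v)) := by
    rw [Subgroup.coe_prod, Subgroup.coe_top]; exact (hK₂o 1).prod isOpen_univ
  have hcpt : IsCompact (((K₂ 1).prod (⊤ : Subgroup ((cmDatum L 1 (Matrix.of fun i j : Fin 1 => if i.val + j.val + 1 = 1 then (1 : L) else 0)).Local v)) : Subgroup _) : Set ((cmDatum L 2 (Matrix.of fun i j : Fin 2 => if i.val + j.val + 1 = 2 then (1 : L) else 0)).Local v × (cmDatum L 1 (Matrix.of fun i j : Fin 1 => if i.val + j.val + 1 = 1 then (1 : L) else 0)).Local v)) := by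
    have h1 := (isCompact_isOpen_cmLocalIntegralLevel L 1 (Matrix.of fun i j : Fin 1 => if i.val + j.val + 1 = 1 then (1 : L) else 0) v).1
    rw [hK1, Subgroup.coe_top] at h1
    rw [Subgroup.coe_prod, Subgroup.coe_top]; exact (hK₂c 1).prod h1
  have hset : {h : ((cmDatum L 2 (Matrix.of fun i j : Fin 2 => if i.val + j.val + 1 = 2 then (1 : L) else 0)).Local v × (cmDatum L 1 (Matrix.of fun i j : Fin 1 => if i.val + j.val + 1 = 1 then (1 : L) else 0)).Local v) | ∀ a b : Fin 2, Valued.v (ϖ ^ (b : ℕ) * (ϖ ^ (a : ℕ))⁻¹ * (((localNonsplitEquiv (IsCMField.complexConj L) (Matrix.of fun i j : Fin 2 => if i.val + j.val + 1 = 2 then (1 : L) else 0) (IsCMField.complexConj_ne_one L) w hw h.1 : ↥(unitaryGroupOfForm (galAdicCompletionMap (L := L) (IsCMField.complexConj L) hw) (placeForm (Matrix.of fun i j : Fin 2 => if i.val + j.val + 1 = 2 then (1 : L) else 0) w.1))) : GL (Fin 2) (w.1.adicCompletion L)) : Matrix (Fin 2) (Fin 2) (w.1.adicCompletion L)) a b)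 ≤ 1} =
      (((K₂ 1).prod (⊤ : Subgroup ((cmDatum L 1 (Matrix.of fun i j : Fin 1 => if i.val + j.val + 1 = 1 then (1 : L) else 0)).Local v)) : Subgroup _) : Set ((cmDatum L 2 (Matrix.of fun i j : Fin 2 => if i.val + j.val + 1 = 2 then (1 : L) else 0)).Local v × (cmDatum L 1 (Matrix.of fun i j : Fin 1 => if i.val + j.val + 1 = 1 then (1 : L) else 0)).Local v)) := by
    ext x
    rw [Set.mem_setOf_eq, SetLike.mem_coe, Subgroup.mem_prod, hd1' x.1,
      coe_mem_map_conj_glDiagonal_iff_forall_v_le_one L w hw ϖu]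
    simp only [diagonal_inv_mul_mul_diagonal_apply_eq, hϖu, Subgroup.mem_top, and_true]
  rw [hset]
  exact isLocSmooth_indicator_subgroup _ hopen hcpt

-- `L_w`-sized statement: elaboration budget only (no search)
set_option maxHeartbeats 1600000 in
open scoped Classical in
/-- **STUB B′ `stub_typeOne_HSideBasis_ram` OF THE v3 P-1-ram SKELETON (8028ac4cce50972f :132), TOKEN FOR TOKEN**: the pinned family `ψ^ram = ![χ⁰, χ♯]` is smooth with compact
support, and near `1`, on the `G`-regular elliptic type-(1) population with split eigen-data `α ≠ γ` at `w` of depth `N`, `Φ^st(γ_H, ψ^ram s) = ν_H(K_H)·Y s N` for `Y : Fin 2 → ℕ → ℂ`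
depending on `N` (and the fixed `ν_H`) only — ★ p846978 read through `![·,·] s`.
[cite: Rogawski1990, §4.9 Lemma 4.9.3 p. 56; §8.1 Prop. 8.1.1 p. 112] [cite: LabesseLanglands1979, §2 Lemma 2.1, §5] -/
theorem stableOrbitalIntegralRel_typeOne_HSidePinnedBasis_ramified
    (L : Type) [Field L] [NumberField L] [IsCMField L]
    {v : HeightOneSpectrum (𝓞 ↥(maximalRealSubfield L))} (w : PlacesOver L v)
    (hw : IsCMField.complexConj L • w.1 = w.1) (he : v.asIdeal.ramificationIdx' w.1.asIdeal ≠ 1)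
    (h2 : IsUnit (2 : 𝒪[(w.1.adicCompletion L)]))
    (ϖ : (w.1.adicCompletion L)) (hϖ : Valued.v ϖ = WithZero.exp (-1 : ℤ)) (hσϖ : galAdicCompletionMap (L := L) (IsCMField.complexConj L) hw ϖ = -ϖ)
    [MeasurableSpace ((cmDatum L 2 (Matrix.of fun i j : Fin 2 => if i.val + j.val + 1 = 2 then (1 : L) else 0)).Local v × (cmDatum L 1 (Matrix.of fun i j : Fin 1 => if i.val + j.val + 1 = 1 then (1 : L) else 0)).Local v)] [BorelSpace ((cmDatum L 2 (Matrix.of fun i j : Fin 2 => if i.val + j.val + 1 = 2 then (1 : L) else 0)).Local v × (cmDatum L 1 (Matrix.of fun i j : Fin 1 => if i.val + j.val + 1 = 1 then (1 : L) else 0)).Local v)]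
    [∀ a : ((cmDatum L 2 (Matrix.of fun i j : Fin 2 => if i.val + j.val + 1 = 2 then (1 : L) else 0)).Local v × (cmDatum L 1 (Matrix.of fun i j : Fin 1 => if i.val + j.val + 1 = 1 then (1 : L) else 0)).Local v), MeasurableSpace (((cmDatum L 2 (Matrix.of fun i j : Fin 2 => if i.val + j.val + 1 = 2 then (1 : L) else 0)).Local v × (cmDatum L 1 (Matrix.of fun i j : Fin 1 => if i.val + j.val + 1 = 1 then (1 : L) else 0)).Local v) ⧸ Subgroup.centralizer ({a} : Set ((cmDatum L 2 (Matrix.of fun i j : Fin 2 => if i.val + j.val + 1 = 2 then (1 : L) else 0)).Local v × (cmDatum L 1 (Matrix.of fun i j : Fin 1 => if i.val + j.val + 1 = 1 then (1 : L) else 0)).Local v)))]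
    [∀ a : ((cmDatum L 2 (Matrix.of fun i j : Fin 2 => if i.val + j.val + 1 = 2 then (1 : L) else 0)).Local v × (cmDatum L 1 (Matrix.of fun i j : Fin 1 => if i.val + j.val + 1 = 1 then (1 : L) else 0)).Local v), BorelSpace (((cmDatum L 2 (Matrix.of fun i j : Fin 2 => if i.val + j.val + 1 = 2 then (1 : L) else 0)).Local v × (cmDatum L 1 (Matrix.of fun i j : Fin 1 => if i.val + j.val + 1 = 1 then (1 : L) else 0)).Local v) ⧸ Subgroup.centralizer ({a} : Set ((cmDatum L 2 (Matrix.of fun i j : Fin 2 => if i.val + j.val + 1 = 2 then (1 : L) else 0)).Local v × (cmDatum L 1 (Matrix.of fun i j : Fin 1 => if i.val + j.val + 1 = 1 then (1 : L) else 0)).Local v)))]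
    (νH : Measure ((cmDatum L 2 (Matrix.of fun i j : Fin 2 => if i.val + j.val + 1 = 2 then (1 : L) else 0)).Local v × (cmDatum L 1 (Matrix.of fun i j : Fin 1 => if i.val + j.val + 1 = 1 then (1 : L) else 0)).Local v)) [νH.IsHaarMeasure] [νH.IsMulRightInvariant]
    {mH : OrbitalMeasureFamily ((cmDatum L 2 (Matrix.of fun i j : Fin 2 => if i.val + j.val + 1 = 2 then (1 : L) else 0)).Local v × (cmDatum L 1 (Matrix.of fun i j : Fin 1 => if i.val + j.val + 1 = 1 then (1 : L) else 0)).Local v)} (hmH : mH.IsCanonical (IsLocalGRegular L v) νH) :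
    (∀ s : Fin 2, IsLocSmooth ((![((((cmLocalIntegralLevel L 2 (Matrix.of fun i j : Fin 2 => if i.val + j.val + 1 = 2 then (1 : L) else 0) v).prod (cmLocalIntegralLevel L 1 (Matrix.of fun i j : Fin 1 => if i.val + j.val + 1 = 1 then (1 : L) else 0) v) : Subgroup _) : Set _).indicator
              (fun h => if (redMat (((h.1.val : GL (Fin 2) (UnitaryGroup.LocalRing L v)).val.map (Pi.evalRingHom (fun w' : PlacesOver L v => w'.1.adicCompletion L) w))) - 1) ^ 2 = 0 ∧ (redMat (((h.1.val : GL (Fin 2) (UnitaryGroup.LocalRing L v)).val.map (Pi.evalRingHom (fun w' : PlacesOver L v => w'.1.adicCompletion L) w))) - 1).rank = 0 then (1 : ℂ) else 0)),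
        (Set.indicator {h : ((cmDatum L 2 (Matrix.of fun i j : Fin 2 => if i.val + j.val + 1 = 2 then (1 : L) else 0)).Local v × (cmDatum L 1 (Matrix.of fun i j : Fin 1 => if i.val + j.val + 1 = 1 then (1 : L) else 0)).Local v) | ∀ a b : Fin 2, Valued.v (ϖ ^ (b : ℕ) * (ϖ ^ (a : ℕ))⁻¹ * (((localNonsplitEquiv (IsCMField.complexConj L) (Matrix.of fun i j : Fin 2 => if i.val + j.val + 1 = 2 then (1 : L) else 0) (IsCMField.complexConj_ne_one L) w hw h.1 : ↥(unitaryGroupOfForm (galAdicCompletionMap (L := L) (IsCMField.complexConj L) hw) (placeForm (Matrix.of fun i j : Fin 2 => if i.val + j.val + 1 = 2 then (1 : L) else 0) w.1))) : GL (Fin 2) (w.1.adicCompletion L)) : Matrix (Fin 2) (Fin 2) (w.1.adicCompletion L)) a b) ≤ 1} (fun _ => (1 : ℂ)))] : Fin 2 → ((cmDatum L 2 (Matrix.of fun i j : Fin 2 => if i.val + j.val + 1 = 2 then (1 : L) else 0)).Local v × (cmDatum L 1 (Matrix.of fun i j : Fin 1 => if i.val + j.val + 1 = 1 then (1 : L)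 else 0)).Local v) → ℂ) s)) ∧
    ∃ Y : Fin 2 → ℕ → ℂ, ∃ V ∈ 𝓝 (1 : ((cmDatum L 2 (Matrix.of fun i j : Fin 2 => if i.val + j.val + 1 = 2 then (1 : L) else 0)).Local v × (cmDatum L 1 (Matrix.of fun i j : Fin 1 => if i.val + j.val + 1 = 1 then (1 : L) else 0)).Local v)),
      ∀ γH ∈ V, IsLocalGRegular L v γH →
        (∃ x : (w.1.adicCompletion L), (((γH.1.val : GL (Fin 2) (UnitaryGroup.LocalRing L v)).val.map
          (Pi.evalRingHom (fun w' : PlacesOver L v => w'.1.adicCompletion L) w)).charpoly).IsRoot x) →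
        ¬ (∃ (y : ((cmDatum L 2 (Matrix.of fun i j : Fin 2 => if i.val + j.val + 1 = 2 then (1 : L) else 0)).Local v × (cmDatum L 1 (Matrix.of fun i j : Fin 1 => if i.val + j.val + 1 = 1 then (1 : L) else 0)).Local v)) (d' : Fin 2 → (UnitaryGroup.LocalRing L v)ˣ),
          glDiagonal 2 (UnitaryGroup.LocalRing L v) d' = ((y * γH * y⁻¹).1.val : GL (Fin 2) (UnitaryGroup.LocalRing L v))) →
        ∀ (α γ : (w.1.adicCompletion L)),
          ((((γH.1.val : GL (Fin 2) (UnitaryGroup.LocalRing L v)) : Matrix (Fin 2) (Fin 2) (UnitaryGroup.LocalRing L v)).charpoly).map (Pi.evalRingHom (fun w' : PlacesOver L v => w'.1.adicCompletion L) w)).IsRoot α →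
          ((((γH.1.val : GL (Fin 2) (UnitaryGroup.LocalRing L v)) : Matrix (Fin 2) (Fin 2) (UnitaryGroup.LocalRing L v)).charpoly).map (Pi.evalRingHom (fun w' : PlacesOver L v => w'.1.adicCompletion L) w)).IsRoot γ →
          α ≠ γ → ∀ N : ℕ, Valued.v (α - γ) = WithZero.exp (-(N : ℤ)) →
          ∀ s : Fin 2, stableOrbitalIntegralRel (IsLocalStablyConjH L v) mH ((![((((cmLocalIntegralLevel L 2 (Matrix.of fun i j : Fin 2 => if i.val + j.val + 1 = 2 then (1 : L) else 0) v).prod (cmLocalIntegralLevel L 1 (Matrix.of fun i j : Fin 1 => if i.val + j.val + 1 = 1 then (1 : L) else 0) v) : Subgroup _) : Set _).indicator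
              (fun h => if (redMat (((h.1.val : GL (Fin 2) (UnitaryGroup.LocalRing L v)).val.map (Pi.evalRingHom (fun w' : PlacesOver L v => w'.1.adicCompletion L) w))) - 1) ^ 2 = 0 ∧ (redMat (((h.1.val : GL (Fin 2) (UnitaryGroup.LocalRing L v)).val.map (Pi.evalRingHom (fun w' : PlacesOver L v => w'.1.adicCompletion L) w))) - 1).rank = 0 then (1 : ℂ) else 0)),
        (Set.indicator {h : ((cmDatum L 2 (Matrix.of fun i j : Fin 2 => if i.val + j.val + 1 = 2 then (1 : L) else 0)).Local v × (cmDatum L 1 (Matrix.of fun i j : Fin 1 => if i.val + j.val + 1 = 1 then (1 : L) else 0)).Local v) | ∀ a b : Fin 2, Valued.v (ϖ ^ (b : ℕ) * (ϖ ^ (a : ℕ))⁻¹ * (((localNonsplitEquiv (IsCMField.complexConj L) (Matrix.of fun i j : Fin 2 => if i.val + j.val + 1 = 2 then (1 : L) else 0) (IsCMField.complexConj_ne_one L) w hw h.1 : ↥(unitaryGroupOfForm (galAdicCompletionMap (L := L) (IsCMField.complexConj L) hw) (placeForm (Matrix.of fun i j : Fin 2 => if i.val + j.val + 1 = 2 then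 (1 : L) else 0) w.1))) : GL (Fin 2) (w.1.adicCompletion L)) : Matrix (Fin 2) (Fin 2) (w.1.adicCompletion L)) a b) ≤ 1} (fun _ => (1 : ℂ)))] : Fin 2 → ((cmDatum L 2 (Matrix.of fun i j : Fin 2 => if i.val + j.val + 1 = 2 then (1 : L) else 0)).Local v × (cmDatum L 1 (Matrix.of fun i j : Fin 1 => if i.val + j.val + 1 = 1 then (1 : L) else 0)).Local v) → ℂ) s) γH = ((νH.real (((cmLocalIntegralLevel L 2 (Matrix.of fun i j : Fin 2 => if i.val + j.val + 1 = 2 then (1 : L) else 0) v).prod (cmLocalIntegralLevel L 1 (Matrix.of fun i j : Fin 1 => if i.val + j.val + 1 = 1 then (1 : L) else 0) v) : Subgroup _) : Set _) : ℝ) : ℂ) * Y s N := by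
  refine ⟨?_, ?_⟩
  · intro s
    fin_cases s
    · simp only [Fin.zero_eta, Matrix.cons_val_zero]
      exact isLocSmooth_indicator_ite_redMat L v w hw 0 _
    · simp only [Fin.mk_one, Matrix.cons_val_one, Matrix.cons_val_zero]
      exact isLocSmooth_indicator_setOf_conj_glDiagonal_ramified L w hw he h2 ϖ hϖ hσϖ
  · obtain ⟨Y, V, hV, h⟩ := stableOrbitalIntegralRel_typeOne_HSideProfiles_ramified L w hw he h2 ϖ hϖ hσϖ νH hmH
    refine ⟨Y, V, hV, ?_⟩
    intro γH hγ hreg hsplit hell α γ hα hγr hαγ N hN s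
    obtain ⟨h0, h1⟩ := h γH hγ hreg hsplit hell α γ hα hγr hαγ N hN
    fin_cases s
    · simp only [Fin.zero_eta, Matrix.cons_val_zero]
      exact h0
    · simp only [Fin.mk_one, Matrix.cons_val_one, Matrix.cons_val_zero]
      exact h1

end Literature.NumberTheory.Rogawski1990

end
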